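import Literature.MathematicalPhysics.QuantumFieldTheory.Balaban1983to89.T4HaarSU2ExpChart
import Literature.MathematicalPhysics.QuantumFieldTheory.GaussianToolkit

/-!
# `Summit.QuantumFields.Balaban3D.Proofs.ChartScalingSU2` — [Balaban1985UV3] p. 260 L19–20 «dU′ = σ(A′)dA′ = σ₀ σ/σ₀ (A′)dA′, σ₀ = σ(0), where dA′ is
# the Lebesque measure on 𝔤» and p. 261 L13 «Finally we make the transformation A → g₀A in (18)» for `G = SU(2)` on ANY finite family of bond
# variables: the product chart law `⊗_i expMeasure` IS the density `Π_i (2π²)⁻¹ sinc²‖A_i‖` times Lebesgue measure on the ball-cube of `(ℝ³)^ι`, and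
# Lebesgue integrals over `(ℝ³)^ι` scale by `g₀^{3|ι|}` under `A = g₀A′` — the source of the `log σ₀|Ω₁*| + d(𝔤) log g₀|Ω₁*|` constants of (18)/(22)
# (seat p4, lane `pub-balaban3d`; step (S3) of HOME/drafts/p4/FIBRE49.md)

HONEST FRAMING (lane PLAN.md §0, binding): see `…Proofs.SectAFirstStep`.  [folklore] (the tree's `GaussianToolkit.pi_withDensity`, Mathlib's
`Measure.integral_comp_smul`); nothing of the paper is asserted.
-/

noncomputable section

namespace Summit.QuantumFields.Balaban3D.Proofs.ChartScalingSU2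

open _root_.MeasureTheory Metric
open scoped ENNReal
open Literature.MathematicalPhysics.QuantumFieldTheory.Balaban1983to89.T4HaarSU2ExpChart (expMeasure expWeight measurable_expWeight
  expWeight_nonneg)

/-- `ℝ³ = 𝔰𝔲(2)` (the chart space of one bond variable). -/
abbrev E3 : Type := EuclideanSpace ℝ (Fin 3)

/-- **THE PRODUCT CHART LAW AS A DENSITY**: `⊗_{i∈ι} expMeasure = (Π_i (2π²)⁻¹ sinc²‖A_i‖) · (Lebesgue on (ℝ³)^ι restricted to the ball-cube ‖A_i‖ < π)`
— print's «dU′ = Π σ(A′(b)) dA′(b)». [cite: Balaban1985UV3, (18) p.260] -/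
theorem pi_expMeasure_eq (ι : Type*) [Fintype ι] :
    (Measure.pi fun _ : ι => expMeasure) =
      ((volume : Measure (ι → E3)).restrict (Set.univ.pi fun _ => ball (0 : E3) Real.pi)).withDensity
        fun A => ∏ i, ENNReal.ofReal (expWeight (A i)) := by
  haveI : ∀ _ : ι, SigmaFinite (((volume : Measure E3).restrict (ball (0 : E3) Real.pi)).withDensity
      fun x => ENNReal.ofReal (expWeight x)) := fun _ => by
    show SigmaFinite expMeasure; infer_instance
  have h := Literature.MathematicalPhysics.QuantumFieldTheory.GaussianToolkit.pi_withDensity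
    (fun _ : ι => (volume : Measure E3).restrict (ball (0 : E3) Real.pi)) (fun _ x => ENNReal.ofReal (expWeight x))
    (fun _ => measurable_expWeight.ennreal_ofReal)
  rw [show (Measure.pi fun _ : ι => expMeasure) = Measure.pi (fun _ : ι => ((volume : Measure E3).restrict (ball (0 : E3) Real.pi)).withDensity
      fun x => ENNReal.ofReal (expWeight x)) from rfl, h, ← Measure.restrict_pi_pi, ← volume_pi]

/-- **INTEGRATION AGAINST THE PRODUCT CHART LAW** as a Lebesgue integral with the density on the ball-cube. [cite: Balaban1985UV3, (18) p.260] -/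
theorem integral_pi_expMeasure {ι : Type*} [Fintype ι] {F : Type*} [NormedAddCommGroup F] [NormedSpace ℝ F] (Φ : (ι → E3) → F) :
    ∫ A, Φ A ∂(Measure.pi fun _ : ι => expMeasure) =
      ∫ A in Set.univ.pi fun _ => ball (0 : E3) Real.pi, (∏ i, expWeight (A i)) • Φ A ∂(volume : Measure (ι → E3)) := by
  rw [pi_expMeasure_eq, integral_withDensity_eq_integral_toReal_smul₀]
  · refine integral_congr_ae (Filter.Eventually.of_forall fun A => ?_)
    simp only
    rw [ENNReal.toReal_prod]
    congr 1
    exact Finset.prod_congr rfl fun i _ => ENNReal.toReal_ofReal (expWeight_nonneg _)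
  · exact (Finset.measurable_prod Finset.univ fun i _ =>
      (measurable_expWeight.comp (measurable_pi_apply i)).ennreal_ofReal).aemeasurable
  · exact Filter.Eventually.of_forall fun A => ENNReal.prod_lt_top fun i _ => ENNReal.ofReal_lt_top

/-- `dim (ℝ³)^ι = 3|ι|`. [folklore] -/
theorem finrank_pi_E3 (ι : Type*) [Fintype ι] : Module.finrank ℝ (ι → E3) = 3 * Fintype.card ι := by
  rw [Module.finrank_pi_fintype, Finset.sum_const, Finset.card_univ, smul_eq_mul, finrank_euclideanSpace, Fintype.card_fin, mul_comm]

/-- **«A → g₀A»**: Lebesgue integrals over `(ℝ³)^ι` scale by `g₀^{3|ι|}` — the factor `exp[d(𝔤) log g₀ |ι|]` of (22), `d(𝔤) = 3`.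
[cite: Balaban1985UV3, (22) p.261] -/
theorem integral_comp_smul_E3 {ι : Type*} [Fintype ι] {F : Type*} [NormedAddCommGroup F] [NormedSpace ℝ F] (Φ : (ι → E3) → F)
    {g₀ : ℝ} (hg : 0 < g₀) :
    ∫ A, Φ A ∂(volume : Measure (ι → E3)) = (g₀ ^ (3 * Fintype.card ι)) • ∫ A, Φ (g₀ • A) ∂(volume : Measure (ι → E3)) := by
  have h := Measure.integral_comp_smul_of_nonneg (volume : Measure (ι → E3)) Φ g₀ (hR := hg.le)
  rw [finrank_pi_E3] at h
  rw [h, smul_smul, mul_inv_cancel₀ (pow_ne_zero _ hg.ne'), one_smul]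

end Summit.QuantumFields.Balaban3D.Proofs.ChartScalingSU2

end
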